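import Summits.RiemannHypothesis.RiemannHypothesis.Theorems.GroundBartaEvenWinsBeyondArchDeflationRitz
import HarnessLib

/-!
# RiemannHypothesis / GroundBarta — rung 4 (`EvenWinsBeyondArch`, stmt-RiemannHypothesis-18807):
# the deflated Temple (Lehmann–Maehly) L-side programme, X — consequences at a window: full bottom, Weil positivity,
# the parity-ladder L-side and the WeilPos rung shape

Helper file (`--supports stmt-RiemannHypothesis-18807`), RH-free, Mathlib + landed tree files only, no
definitions, no named facts.

Glue turning the two sector bounds of file IX (`dt_weilEvenGroundEnergy_ge_of_ritz`, `dt_weilOddGroundEnergy_ge_of_ritz`)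
into the shapes the consumers want:

* `dt_weilGroundEnergy_ge` — `λ ≤ ε_ev(c)` and `λ ≤ ε_od(c)` give `λ ≤ ε(c)` (`ε = min(ε_ev, ε_od)`, parity splitting,
  tree `weilGroundEnergy_eq_min_even_odd`);
* `dt_re_weilQuadratic_ge` — hence `λ ∫|g|² ≤ Re Q(g)` for EVERY smooth test supported in `[-c, c]` (the shape of route
  WeilPos's rungs, e.g. `WeilposSlackRungLog2` at `c = log 2` with `λ = -1`, and of the exact rung `WeilPositivityOn c` with
  `λ = 0`);
* `dt_weilPositivityOn` — `0 ≤ ε_ev(c)` and `0 ≤ ε_od(c)` give `WeilPositivityOn c` (Yoshida's finite-window positivity;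
  at `c = log 2` this is `E₂₃ ≥ 0`, not in print beyond the one-prime window);
* `dt_oddLower_of_ritz` — the odd bound in the L-SIDE shape of the parity ladder (`∀` odd normalised tests on `[-c, c]`,
  `λ ≤ Re Q`), i.e. the form of the tree's `oddLowerK67` / `oddLowerI65` consumed by `weilWindowSimpleEven_on_cell_of_le`.

Prover B, speedrun unit `sr-gb-rung-b` (gen 3).

References: E. Bombieri, Rend. Mat. Acc. Lincei (9) 11 (2000) 183–233, §4 (parity splitting, Thm 5); H. Yoshida, Adv.
Stud. Pure Math. 21 (1992) Thm 1; A. Weinstein, W. Stenger (1972) Ch. 5 §9.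
-/

set_option linter.dupNamespace false

noncomputable section

open MeasureTheory Set Filter
open scoped Topology ENNReal NNReal ComplexConjugate BigOperators

namespace Summit.RiemannHypothesis.RiemannHypothesis.Theorems.EvenWinsBeyondArch

open Literature.NumberTheory.LFunctions Literature.NumberTheory.LFunctions.ConnesVanSuijlekom
open Summit.RiemannHypothesis.RiemannHypothesis.Theorems.OddSector (weilDirichletEnergy₂ weilPoleForm₂)

/-- **Sector bounds give the full bottom**: `λ ≤ ε_ev(c)` and `λ ≤ ε_od(c)` imply `λ ≤ ε(c)`. -/
theorem dt_weilGroundEnergy_ge {c lam : ℝ} (hev : lam ≤ weilEvenGroundEnergy c) (hod : lam ≤ weilOddGroundEnergy c) :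
    lam ≤ weilGroundEnergy c := by
  rw [weilGroundEnergy_eq_min_even_odd]
  exact le_min hev hod

/-- **The homogeneous shape**: `λ ≤ ε_ev(c)`, `λ ≤ ε_od(c)` imply `λ ∫|g|² ≤ Re Q(g)` for every smooth test `g` supported in
`[-c, c]` — the shape of route WeilPos's rungs (`λ = -1`: the slack rung; `λ = 0`: exact positivity). -/
theorem dt_re_weilQuadratic_ge {c lam : ℝ} (hev : lam ≤ weilEvenGroundEnergy c) (hod : lam ≤ weilOddGroundEnergy c)
    {g : ℝ → ℂ} (hg : IsWeilTest g) (hgs : tsupport g ⊆ Icc (-c) c) :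
    lam * ∫ x, ‖g x‖ ^ 2 ≤ (weilQuadratic g).re := by
  have h1 := weilGroundEnergy_mul_le_re hg hgs
  have h2 := dt_weilGroundEnergy_ge hev hod
  have hN : 0 ≤ ∫ x, ‖g x‖ ^ 2 := integral_nonneg fun _ ↦ by positivity
  nlinarith

/-- **Weil positivity at a window from non-negative sector bounds**: `0 ≤ ε_ev(c)` and `0 ≤ ε_od(c)` imply
`WeilPositivityOn c`. -/
theorem dt_weilPositivityOn {c : ℝ} (hev : 0 ≤ weilEvenGroundEnergy c) (hod : 0 ≤ weilOddGroundEnergy c) :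
    WeilPositivityOn c := by
  intro g hg hgs
  have h := dt_re_weilQuadratic_ge hev hod hg hgs
  simpa using h

/-- **Weil positivity at a window from two Ritz certificates** (even sector with `λ_ev ≥ 0`, odd sector with
`λ_od ≥ 0`; inputs as in `dt_weil{Even,Odd}GroundEnergy_ge_of_ritz`). -/
theorem dt_weilPositivityOn_of_ritz {c : ℝ} (hc : 0 < c)
    -- even sector data
    {ke : ℕ} (ge : Fin ke → ℝ → ℝ) (hge : ∀ i, ContDiff ℝ 2 (ge i)) (hgee : ∀ i x, ge i (-x) = ge i x)
    (ve Fe : Fin ke → ℝ → ℂ) (hve : ∀ i x, ve i x = (((Icc (-c) c).indicator (ge i) x : ℝ) : ℂ))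
    (hFe : ∀ i y, Fe i y = (Icc (-c) c).indicator (fun y ↦
        2 * (∫ x, ve i x * (Real.cosh (x / 2) : ℂ)) * (Real.cosh (y / 2) : ℂ) -
          2 * (∫ x, ve i x * (Real.sinh (x / 2) : ℂ)) * (Real.sinh (y / 2) : ℂ) +
        (∑ n ∈ weilPrimeIndex c, (((ArithmeticFunction.vonMangoldt n : ℝ) / Real.sqrt n : ℝ) : ℂ) *
          (2 * ve i y - ve i (y - Real.log n) - ve i (y + Real.log n))) +
        ∫ t in Ioi 0, (weilArchDensity t : ℂ) * (2 * ve i y - ve i (y - t) - ve i (y + t))) y -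
      (weilMarkovConstant c : ℂ) * ve i y)
    (We : Fin ke → Fin ke → ℝ) (μe : Fin ke → ℝ) {βe lame : ℝ} (hlame : lame < βe) (hμe : ∀ i, 0 ≤ μe i)
    (hlame0 : 0 ≤ lame)
    (hcerte : ∀ φ : ℝ → ℂ, IsWeilTest φ → tsupport φ ⊆ Icc (-c) c → (∀ x, φ (-x) = φ x) →
      βe * ∫ x, ‖φ x‖ ^ 2 ≤ (weilQuadratic φ).re + ∑ i, μe i * ‖∫ x, φ x * conj (ve i x)‖ ^ 2)
    (hPSDe : ∀ α : Fin ke → ℝ, 0 ≤ ∑ i, ∑ j, α i * α j *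
      ((βe - lame) * ((weilPoleForm₂ (ve i) (ve j) + weilDirichletEnergy₂ c (ve i) (ve j) -
          weilMarkovConstant c * ∫ x, (ve i x * conj (ve j x)).re) - lame * ∫ x, (ve i x * conj (ve j x)).re) -
        ∫ x, ((Fe i - ∑ l, We i l • ve l) x * conj ((Fe j - ∑ l, We j l • ve l) x)).re))
    -- odd sector data
    {ko : ℕ} (go : Fin ko → ℝ → ℝ) (hgo : ∀ i, ContDiff ℝ 2 (go i)) (hgoo : ∀ i x, go i (-x) = -go i x)
    (vo Fo : Fin ko → ℝ → ℂ) (hvo : ∀ i x, vo i x = (((Icc (-c) c).indicator (go i) x : ℝ) : ℂ))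
    (hFo : ∀ i y, Fo i y = (Icc (-c) c).indicator (fun y ↦
        2 * (∫ x, vo i x * (Real.cosh (x / 2) : ℂ)) * (Real.cosh (y / 2) : ℂ) -
          2 * (∫ x, vo i x * (Real.sinh (x / 2) : ℂ)) * (Real.sinh (y / 2) : ℂ) +
        (∑ n ∈ weilPrimeIndex c, (((ArithmeticFunction.vonMangoldt n : ℝ) / Real.sqrt n : ℝ) : ℂ) *
          (2 * vo i y - vo i (y - Real.log n) - vo i (y + Real.log n))) +
        ∫ t in Ioi 0, (weilArchDensity t : ℂ) * (2 * vo i y - vo i (y - t) - vo i (y + t))) y -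
      (weilMarkovConstant c : ℂ) * vo i y)
    (Wo : Fin ko → Fin ko → ℝ) (μo : Fin ko → ℝ) {βo lamo : ℝ} (hlamo : lamo < βo) (hμo : ∀ i, 0 ≤ μo i)
    (hlamo0 : 0 ≤ lamo)
    (hcerto : ∀ φ : ℝ → ℂ, IsWeilTest φ → tsupport φ ⊆ Icc (-c) c → (∀ x, φ (-x) = -φ x) →
      βo * ∫ x, ‖φ x‖ ^ 2 ≤ (weilQuadratic φ).re + ∑ i, μo i * ‖∫ x, φ x * conj (vo i x)‖ ^ 2)
    (hPSDo : ∀ α : Fin ko → ℝ, 0 ≤ ∑ i, ∑ j, α i * α j *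
      ((βo - lamo) * ((weilPoleForm₂ (vo i) (vo j) + weilDirichletEnergy₂ c (vo i) (vo j) -
          weilMarkovConstant c * ∫ x, (vo i x * conj (vo j x)).re) - lamo * ∫ x, (vo i x * conj (vo j x)).re) -
        ∫ x, ((Fo i - ∑ l, Wo i l • vo l) x * conj ((Fo j - ∑ l, Wo j l • vo l) x)).re)) :
    WeilPositivityOn c :=
  dt_weilPositivityOn
    (hlame0.trans (dt_weilEvenGroundEnergy_ge_of_ritz hc ge hge hgee ve Fe hve hFe We μe hlame hμe hcerte hPSDe))
    (hlamo0.trans (dt_weilOddGroundEnergy_ge_of_ritz hc go hgo hgoo vo Fo hvo hFo Wo μo hlamo hμo hcerto hPSDo))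

/-- **The parity-ladder L-side from an odd Ritz certificate**: in the shape consumed by the window cells of
item 18085 / 18807 (`∀` odd `L²`-normalised tests on `[-c, c]`: `λ ≤ Re Q`; compare the tree's `oddLowerK67`). -/
theorem dt_oddLower_of_ritz {c : ℝ} (hc : 0 < c) {k : ℕ}
    (g : Fin k → ℝ → ℝ) (hg : ∀ i, ContDiff ℝ 2 (g i)) (hgo : ∀ i x, g i (-x) = -g i x)
    (v F : Fin k → ℝ → ℂ) (hv : ∀ i x, v i x = (((Icc (-c) c).indicator (g i) x : ℝ) : ℂ))
    (hF : ∀ i y, F i y = (Icc (-c) c).indicator (fun y ↦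
        2 * (∫ x, v i x * (Real.cosh (x / 2) : ℂ)) * (Real.cosh (y / 2) : ℂ) -
          2 * (∫ x, v i x * (Real.sinh (x / 2) : ℂ)) * (Real.sinh (y / 2) : ℂ) +
        (∑ n ∈ weilPrimeIndex c, (((ArithmeticFunction.vonMangoldt n : ℝ) / Real.sqrt n : ℝ) : ℂ) *
          (2 * v i y - v i (y - Real.log n) - v i (y + Real.log n))) +
        ∫ t in Ioi 0, (weilArchDensity t : ℂ) * (2 * v i y - v i (y - t) - v i (y + t))) y -
      (weilMarkovConstant c : ℂ) * v i y)
    (W : Fin k → Fin k → ℝ) (μ : Fin k → ℝ) {β lam : ℝ} (hlam : lam < β) (hμ : ∀ i, 0 ≤ μ i)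
    (hcert : ∀ φ : ℝ → ℂ, IsWeilTest φ → tsupport φ ⊆ Icc (-c) c → (∀ x, φ (-x) = -φ x) →
      β * ∫ x, ‖φ x‖ ^ 2 ≤ (weilQuadratic φ).re + ∑ i, μ i * ‖∫ x, φ x * conj (v i x)‖ ^ 2)
    (hPSD : ∀ α : Fin k → ℝ, 0 ≤ ∑ i, ∑ j, α i * α j *
      ((β - lam) * ((weilPoleForm₂ (v i) (v j) + weilDirichletEnergy₂ c (v i) (v j) -
          weilMarkovConstant c * ∫ x, (v i x * conj (v j x)).re) - lam * ∫ x, (v i x * conj (v j x)).re) -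
        ∫ x, ((F i - ∑ l, W i l • v l) x * conj ((F j - ∑ l, W j l • v l) x)).re)) :
    ∀ o : ℝ → ℂ, IsWeilTest o → tsupport o ⊆ Icc (-c) c → (∀ x, o (-x) = -o x) →
      ∫ x, ‖o x‖ ^ 2 = 1 → lam ≤ (weilQuadratic o).re := by
  intro o ho hos hoo hon
  have h := dt_sector_bound_of_ritz hc (-1) g hg (fun i x ↦ by rw [hgo i x]; ring) v F hv hF W μ hlam hμ
    (fun φ hφ hφs hφp ↦ hcert φ hφ hφs (fun x ↦ by simpa using hφp x)) hPSD ho hos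
    (fun x ↦ by simpa using hoo x)
  rwa [hon, mul_one] at h

end Summit.RiemannHypothesis.RiemannHypothesis.Theorems.EvenWinsBeyondArch

end
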